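import Literature.Analysis.PDE.SchauderInteriorBallHolder
import HarnessLib

/-!
# Helper `helper_schauderInteriorBallC2` of line `margerin-cone-hamilton-rails`
# (crux `EntropyRung.ChangGurskyYang`, item stmt-SmoothPoincare4-10834):
# the interior Schauder estimate on concentric balls for `C^{2,α}` functions

Registered helper stub R1 of the lead's skeleton of line `margerin-cone-hamilton-rails` (the
engine of the elliptic-regularity stub O3 `stub_regularity`: difference quotients of a `C^{2,α}`
solution are only `C^{2,α}`, so the a-priori interior estimate must be available for genuinely
`C^{2,α}` functions, not just smooth ones). Gilbarg–Trudinger 2001, Cor. 6.3 (with Thm. 6.2), on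
concentric balls `B(x₀, ρ) ⊂ B(x₀, R)` for pure second-order operators
`P v = ∑ᵢⱼ aⁱʲ D²v(eᵢ, eⱼ)` with symmetric, `λ`-`Λ`-elliptic, bounded, `α`-Hölder coefficients:

  `sup_{B_ρ} |D²v| + [D²v]_{α; B_ρ} ≤ C(n, α, λ, Λ, K_a, ρ, R) · B`

whenever `v ∈ C²(B_R)` has an `α`-Hölder second derivative on `B_R` (constant `H`, which does
NOT enter the bound) and `|P v|, [P v]_α, |v|, |Dv|, [Dv]_α ≤ B` on `B_R`.

This file is a wrapper: the mathematics is the Literature theorem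
`Literature.Analysis.PDE.exists_schauder_interior_ball_of_holder`
(`Literature/Analysis/PDE/SchauderInteriorBallHolder.lean`, with the `C²` cut-off calculus in
`SchauderInteriorBallHolderAux.lean`), whose statement is this stub's signature; the smooth case
is the older `Literature.Analysis.PDE.exists_schauder_interior_ball`.

References: D. Gilbarg, N. S. Trudinger, *Elliptic Partial Differential Equations of Second
Order* (2001), Thm. 6.2, Cor. 6.3 [GilbargTrudinger2001].
-/

noncomputable section

-- every `Summit.SmoothPoincare4.SmoothPoincare4.…` name repeats the summit = sub-problem segment (D-0017 layout)
set_option linter.dupNamespace false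

namespace Summit.SmoothPoincare4.SmoothPoincare4.Theorems.MargerinRails

/-- **R1: interior Schauder estimate on concentric balls for `C^{2,α}` (not necessarily smooth)
functions** (Gilbarg–Trudinger 2001, Cor. 6.3 for `b = c = 0`, a-priori form): for `0 < α < 1`,
ellipticity `0 < λ ≤ Λ`, a Hölder bound `K_a` of the coefficients and radii `0 < ρ < R` there is
`C` such that for all symmetric `λ`-`Λ`-elliptic coefficients `aⁱʲ` with `|aⁱʲ|, [aⁱʲ]_α ≤ K_a`
on `B_R = B(x₀, R)` and every `v ∈ C²(B_R)` with `[D²v]_{α;B_R} ≤ H` (any `H`) solving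
`∑ aⁱʲ D²v(eᵢ,eⱼ) = f` on `B_R` with `|f|, [f]_α, |v|, |Dv|, [Dv]_α ≤ B` there:
`|D²v| ≤ C·B` on `B_ρ` and `[D²v]_{α;B_ρ} ≤ C·B`. This is
`Literature.Analysis.PDE.exists_schauder_interior_ball_of_holder`.
[cite: GilbargTrudinger2001, Cor. 6.3] -/
theorem helper_schauderInteriorBallC2 :
    ∀ {ι : Type} [Fintype ι] [DecidableEq ι] {E : Type} [NormedAddCommGroup E] [InnerProductSpace ℝ E]
      [FiniteDimensional ℝ E] [MeasurableSpace E] [BorelSpace E] [Nontrivial E]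
      (bE : OrthonormalBasis ι ℝ E) {α : NNReal}, 0 < α → α < 1 → ∀ {l : ℝ}, 0 < l →
      ∀ (L : ℝ) (Ka : NNReal) (x₀ : E) {ρ R : ℝ}, 0 < ρ → ρ < R →
      ∃ C : NNReal, ∀ (a : ι → ι → E → ℝ),
        (∀ i j x, a i j x = a j i x) →
        (∀ x ∈ Metric.ball x₀ R, ∀ ξ : ι → ℝ, l * ∑ i, ξ i ^ 2 ≤ ∑ i, ∑ j, a i j x * ξ i * ξ j) →
        (∀ x ∈ Metric.ball x₀ R, ∀ ξ : ι → ℝ, ∑ i, ∑ j, a i j x * ξ i * ξ j ≤ L * ∑ i, ξ i ^ 2) →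
        (∀ i j, ∀ x ∈ Metric.ball x₀ R, ‖a i j x‖ ≤ Ka) →
        (∀ i j, HolderOnWith Ka α (a i j) (Metric.ball x₀ R)) →
        ∀ (v f : E → ℝ) (B H : NNReal), ContDiffOn ℝ 2 v (Metric.ball x₀ R) →
          HolderOnWith H α (iteratedFDeriv ℝ 2 v) (Metric.ball x₀ R) →
          (∀ x ∈ Metric.ball x₀ R, (∑ i, ∑ j, a i j x * iteratedFDeriv ℝ 2 v x ![bE i, bE j]) = f x) →
          (∀ x ∈ Metric.ball x₀ R, ‖f x‖ ≤ B) → HolderOnWith B α f (Metric.ball x₀ R) →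
          (∀ x ∈ Metric.ball x₀ R, ‖v x‖ ≤ B) → (∀ x ∈ Metric.ball x₀ R, ‖fderiv ℝ v x‖ ≤ B) →
          HolderOnWith B α (fderiv ℝ v) (Metric.ball x₀ R) →
          (∀ x ∈ Metric.ball x₀ ρ, ‖iteratedFDeriv ℝ 2 v x‖ ≤ C * B) ∧
            HolderOnWith (C * B) α (iteratedFDeriv ℝ 2 v) (Metric.ball x₀ ρ) := by
  intro ι _ _ E _ _ _ _ _ _ bE α hα0 hα1 l hl L Ka x₀ ρ R hρ hρR
  exact Literature.Analysis.PDE.exists_schauder_interior_ball_of_holder bE hα0 hα1 hl L Ka x₀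
    hρ hρR

end Summit.SmoothPoincare4.SmoothPoincare4.Theorems.MargerinRails
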